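import Literature.NumberTheory.GelbartRogawski1991.UndoublingPlaceAssembly
import Literature.NumberTheory.GelbartRogawski1991.DoubledWeilRepresentationCMExplicit
import Literature.NumberTheory.GelbartRogawski1991.LocalSplittingUnitary
import HarnessLib

/-!
# The undoubled CM families of local splittings `undoubledSplittings (cmFinLocalFamily χ)` — and their `congrW`
# transports — are UNITARY at every finite place

Topic `NumberTheory/GelbartRogawski1991`; namespaces `…UnitaryDualPair.LocalSplitting` (§1) and `…GRConstruction` (§2–§3).
KERNEL ONLY: theorems; no definition, no named fact, no `sorry`.  Sequel of `LocalSplittingUnitary.lean` (the local Weil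
representation of ANY local splitting datum with `|β| = 1` is `L²`-isometric; the CM data have `|β| = 1` for a unitary
splitting character) for the SHAPE of family the Hodge/COR-CM cell consumes
(`Summits/…/Transposition/Item6MuLocalSplittings.muLocalSplittings = congrW … (undoubledSplittings … (chiMu …) (borelPlaceMeasure …)
(cmFinLocalFamily …))`):

* §1 `FinLocalSplittings.isL2Isometric_omegaLoc_of_undouble` — GENERIC: if a family `𝓢` of local splittings of `U(J)(F_v)`
  consists of the local undoublings of a doubled family `𝓢D` (`𝓢.s v = undoubleLoc (𝓢D.s v)`) and `𝓢D.omegaLoc v` is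
  `L²(μ'^{n+n})`-isometric, then `𝓢.omegaLoc v` is `L²(μ'^n)`-isometric (`ω^𝔻(g ⊕ 1)(f₁ ⊠ f₂) = ω(g)f₁ ⊠ f₂`, tree
  `omegaLoc_inlLoc_boxSB`, and `Automorphic/SchwartzBruhatL2NormDirectSum.l2NormSq_eq_of_boxSB_linear`);
* §2 `isL2Isometric_omegaLoc_finSplittings_cmFinLocalFamily` — the doubled per-place package at the CM datum
  (`cmFinLocalFamily`, Haar data `𝔪`) is unitary at `v` for every Borel structure / Haar measure `μ'` on `L⁺_v`
  (`χ` unitary); `isL2Isometric_omegaLoc_undoubledSplittings_cmFinLocalFamily` — so is its undoubling;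
* §3 `isL2Isometric_omegaLoc_congrW` — transport along equal W-side Gram data preserves unitarity;
  **`isL2Isometric_omegaLoc_congrW_undoubledSplittings_cmFinLocalFamily`** — the consumers' shape.

With `Liu2021/LemD1DataOfPlaceIsometric.forall_lemD1_1AsPrinted_iff_of_isL2Isometric`: the per-place cite `hD1` of the cell,
read at `muLocalSplittings`, has the same truth value at every unitary family of local splittings over `ι_v` — at EVERY
finite place, unconditionally.  Nothing of [GelbartRogawski1991] / [Liu2021] is asserted.

## References
* [GelbartRogawski1991] S. Gelbart, J. Rogawski, Invent. Math. 105 (1991), §3.1 Prop. 3.1.1 p. 455, Remark p. 457.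
* [Weil1964] A. Weil, Acta Math. 111 (1964), Chap. I n° 13.
* [MoeglinVignerasWaldspurger1987] C. Mœglin, M.-F. Vignéras, J.-L. Waldspurger, LNM 1291 (1987), Chap. 2 II.1 Rem. (6).
-/

set_option autoImplicit false

noncomputable section

open scoped Matrix Kronecker
open NumberField IsDedekindDomain _root_.MeasureTheory
open Literature.RepresentationTheory.HeisenbergGroup
open Literature.NumberTheory.Automorphic
open Literature.NumberTheory.Weil1964
open Literature.RepresentationTheory.HarrisKudlaSweet1996
open Literature.NumberTheory.GaloisRepresentations

/-! ## §1 Generic: unitarity passes from a doubled family to its local undoublings -/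

namespace Literature.NumberTheory.GelbartRogawski1991.UnitaryDualPair.LocalSplitting

namespace FinLocalSplittings

variable {F : Type} [Field F] [NumberField F] {E : Type} [Field E] [NumberField E] [Algebra F E] {c : E ≃ₐ[F] E}
  {n : ℕ} {T₀ : Matrix (Fin n) (Fin n) F} {J : Matrix (Fin n) (Fin n) E} (hJ : J = T₀.map (algebraMap F E))
  {JD : Matrix (Fin (n + n)) (Fin (n + n)) E} {hJD : JD = (gramD F n T₀).map (algebraMap F E)}
  [Algebra.IsQuadraticExtension F E] {δ : E} {hcδ : c δ = -δ} {hδ : δ ≠ 0} {d : F} {hd : δ * δ = algebraMap F E d}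
  (hT₀ : T₀.IsSymm) (hT₀d : IsUnit T₀.det)
  (𝓢D : FinLocalSplittings F E c (n + n) hcδ hδ hd (gramD F n T₀) (gramD_isSymm F n hT₀) hJD)
  (𝓢 : FinLocalSplittings F E c n hcδ hδ hd T₀ hT₀ hJ)
  (hs : ∀ v, 𝓢.s v = undoubleLoc F E c v n hJ hJD hcδ hδ hd hT₀ hT₀d (𝓢D.s v) (𝓢D.proj_s v))
  (v : HeightOneSpectrum (𝓞 F)) [MeasurableSpace (v.adicCompletion F)] [BorelSpace (v.adicCompletion F)]
  (μ' : Measure (v.adicCompletion F)) [μ'.IsAddHaarMeasure]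

include hs in
/-- **unitarity passes to the local undoublings**: if `𝓢.s v = undoubleLoc (𝓢D.s v)` for all `v` and `𝓢D.omegaLoc v` is
`L²(μ'^{n+n})`-isometric, then `𝓢.omegaLoc v` is `L²(μ'^n)`-isometric — `ω^𝔻_v(g ⊕ 1)(f₁ ⊠ f₂) = (ω_v(g) f₁) ⊠ f₂` with
`f₂ ≠ 0`, and an isometry of `𝒮((F_v)^{n+n})` of this shape strips to an isometry of `𝒮((F_v)^n)`.
[cite: MoeglinVignerasWaldspurger1987, Chap. 2 II.1 Rem. (6)] [cite: GelbartRogawski1991, §3.1 Prop. 3.1.1 p. 455 L1–3] -/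
theorem isL2Isometric_omegaLoc_of_undouble
    (hD : (𝓢D.omegaLoc v).IsL2Isometric (Measure.pi fun _ : Fin (n + n) => μ')) :
    (𝓢.omegaLoc v).IsL2Isometric (Measure.pi fun _ : Fin n => μ') := by
  intro g f₁
  haveI : Nontrivial (SchwartzBruhat (Fin n → v.adicCompletion F)) := nontrivial_schwartzBruhat_pi
  obtain ⟨f₂, hf₂⟩ := exists_ne (0 : SchwartzBruhat (Fin n → v.adicCompletion F))
  exact l2NormSq_eq_of_boxSB_linear (v.adicCompletion F) μ' (e₂ n) (𝓢D.omegaLoc v (inlLoc F E c v n hJ hJD g))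
    (hD _) (𝓢.omegaLoc v g) hf₂ (fun f => 𝓢D.omegaLoc_inlLoc_boxSB hJ hT₀ hT₀d 𝓢 hs v g f f₂) f₁

end FinLocalSplittings

end Literature.NumberTheory.GelbartRogawski1991.UnitaryDualPair.LocalSplitting

/-! ## §2–§3 The CM per-place package, its undoubling, and the `congrW` transport -/

namespace Literature.NumberTheory.GelbartRogawski1991.GRConstruction

open UnitaryDualPair
open Literature.NumberTheory.GelbartRogawski1991.UnitaryDualPair.LocalSplitting hiding IsSiegelDelta chiDet deltaBlock
  detDelta e₂ gramD gramD_isSymm gramS hermD isUnit_det_gramD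

variable (L : Type) [Field L] [NumberField L] [IsCMField L]
variable {N M n : ℕ} (e : Fin N × Fin M ≃ Fin n)
  (dV : Fin N → L) (hdV : ∀ i, IsCMField.complexConj L (dV i) = dV i) (hdV0 : ∀ i, dV i ≠ 0)
  (dW : Fin M → L) (hdW : ∀ i, IsCMField.complexConj L (dW i) = dW i) (hdW0 : ∀ i, dW i ≠ 0)
  (χ : HeckeCharacter L) (hχ : IsSplittingChar L 1 χ) (𝔪 : ∀ v, PlaceMeasure L v)
  (v : HeightOneSpectrum (𝓞 (Fp L)))

/-- **the doubled per-place package at the CM datum is unitary at `v`**: for every Borel structure and Haar measure `μ'` on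
`L⁺_v`, `(finSplittings (cmFinLocalFamily χ)).omegaLoc v` is `L²(μ'^{n+n})`-isometric (`χ` unitary) — the datum at `v` is
`localSplittingDatumCM … (𝔪 v).μ …` (`|β| = 1`, Leray–Rao section unitary). [cite: Kudla1994, Thm 3.1] [cite: Weil1964, Chap. I n° 13] -/
theorem isL2Isometric_omegaLoc_finSplittings_cmFinLocalFamily (hχu : χ.IsUnitary)
    [inst : MeasurableSpace (v.adicCompletion (Fp L))] [BorelSpace (v.adicCompletion (Fp L))]
    (μ' : Measure (v.adicCompletion (Fp L))) [μ'.IsAddHaarMeasure] :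
    ((finSplittings L e dV hdV hdV0 dW hdW hdW0 χ 𝔪
        (cmFinLocalFamily L e dV hdV hdV0 dW hdW hdW0 χ hχ 𝔪)).omegaLoc v).IsL2Isometric
      (Measure.pi fun _ : Fin (n + n) => μ') := by
  -- align the Borel structure of the statement with the package's `(𝔪 v).mS`
  have h1 : inst = (𝔪 v).mS := by
    have a : inst = borel _ := BorelSpace.measurable_eq
    have b : (𝔪 v).mS = borel _ := by
      letI := (𝔪 v).mS
      exact (𝔪 v).isBorel.measurable_eq
    rw [a, b]
  subst h1
  letI : MeasurableSpace (v.adicCompletion (Fp L)) := (𝔪 v).mS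
  haveI := (𝔪 v).isHaar
  intro g Φ
  exact (localSplittingDatumCM L v (𝔪 v).μ n (T₀ := gramR L e dV hdV dW hdW) (gramR_isSymm L e dV hdV dW hdW)
    (isUnit_det_gramR₀ L e dV hdV hdV0 dW hdW hdW0) (JD := hermD L e dV hdV dW hdW) (hermD_eq_map_gramD L e dV hdV dW hdW)
    χ hχ).isL2Isometric_localOmega_of_norm_beta μ'
    (norm_beta_localSplittingDatumCM_eq_one n L v (𝔪 v).μ (gramR_isSymm L e dV hdV dW hdW)
      (isUnit_det_gramR₀ L e dV hdV hdV0 dW hdW hdW0) (hermD_eq_map_gramD L e dV hdV dW hdW) χ hχ hχu) g Φ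

/-- **the undoubled CM family `undoubledSplittings (cmFinLocalFamily χ)` is unitary at every finite place** (`χ` unitary;
any Borel structure, any Haar `μ'` on `L⁺_v`). [cite: GelbartRogawski1991, §3.1 Prop. 3.1.1 p. 455 L1–3] [cite: Weil1964, Chap. I n° 13] -/
theorem isL2Isometric_omegaLoc_undoubledSplittings_cmFinLocalFamily (hχu : χ.IsUnitary)
    [MeasurableSpace (v.adicCompletion (Fp L))] [BorelSpace (v.adicCompletion (Fp L))]
    (μ' : Measure (v.adicCompletion (Fp L))) [μ'.IsAddHaarMeasure] :
    ((undoubledSplittings L e dV hdV hdV0 dW hdW hdW0 χ 𝔪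
        (cmFinLocalFamily L e dV hdV hdV0 dW hdW hdW0 χ hχ 𝔪)).omegaLoc v).IsL2Isometric
      (Measure.pi fun _ : Fin n => μ') :=
  FinLocalSplittings.isL2Isometric_omegaLoc_of_undouble
    (reindex_kronecker_eq_gram_map (Fp L) L e (realDiagonal_map L dV hdV).symm (realDiagonal_map L dW hdW).symm)
    (gramR_isSymm L e dV hdV dW hdW) (isUnit_det_gramR₀ L e dV hdV hdV0 dW hdW hdW0)
    (finSplittings L e dV hdV hdV0 dW hdW hdW0 χ 𝔪 (cmFinLocalFamily L e dV hdV hdV0 dW hdW hdW0 χ hχ 𝔪)) _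
    (fun _ => rfl) v μ'
    (isL2Isometric_omegaLoc_finSplittings_cmFinLocalFamily L e dV hdV hdV0 dW hdW hdW0 χ hχ 𝔪 v hχu μ')

variable {TW' : Matrix (Fin M) (Fin M) (Fp L)} {JW' : Matrix (Fin M) (Fin M) L}

/-- **`congrW` preserves unitarity** (it is a transport along equalities of the W-side Gram data).
[cite: GelbartRogawski1991, §3.1 Prop. 3.1.1 p. 455 L1–3] -/
theorem isL2Isometric_omegaLoc_congrW (hT : realDiagonal L dW hdW = TW') (hJ : Matrix.diagonal dW = JW')
    (𝓢 : FinLocalSplittings (Fp L) L (IsCMField.complexConj L) n (complexConj_imagUnit L) (imagUnit_ne_zero L)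
      (imagUnit_mul_self L) (gramR L e dV hdV dW hdW) (gramR_isSymm L e dV hdV dW hdW)
      (J := Matrix.reindex e e (Matrix.diagonal dV ⊗ₖ Matrix.diagonal dW))
      (reindex_kronecker_eq_gram_map (Fp L) L e (realDiagonal_map L dV hdV).symm (realDiagonal_map L dW hdW).symm))
    (hW' : TW'.IsSymm) (hJW' : JW' = TW'.map (algebraMap (Fp L) L))
    [MeasurableSpace (v.adicCompletion (Fp L))] (ν : Measure (Fin n → v.adicCompletion (Fp L)))
    (h : (𝓢.omegaLoc v).IsL2Isometric ν) :
    ((congrW L e dV hdV dW hdW hT hJ 𝓢 hW' hJW').omegaLoc v).IsL2Isometric ν := by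
  subst hT hJ
  exact h

/-- **THE CONSUMERS' SHAPE: `congrW hT hJ (undoubledSplittings (cmFinLocalFamily χ))` is unitary at every finite place**
(`χ` unitary; any Borel structure and Haar `μ'` on `L⁺_v`) — e.g. the Hodge/COR-CM cell's `muLocalSplittings`
(`χ = chiMu`, unitary). [cite: GelbartRogawski1991, §3.1 Prop. 3.1.1 p. 455 L1–3] [cite: Weil1964, Chap. I n° 13] -/
theorem isL2Isometric_omegaLoc_congrW_undoubledSplittings_cmFinLocalFamily (hχu : χ.IsUnitary)
    (hT : realDiagonal L dW hdW = TW') (hJ : Matrix.diagonal dW = JW') (hW' : TW'.IsSymm)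
    (hJW' : JW' = TW'.map (algebraMap (Fp L) L))
    [MeasurableSpace (v.adicCompletion (Fp L))] [BorelSpace (v.adicCompletion (Fp L))]
    (μ' : Measure (v.adicCompletion (Fp L))) [μ'.IsAddHaarMeasure] :
    ((congrW L e dV hdV dW hdW hT hJ
        (undoubledSplittings L e dV hdV hdV0 dW hdW hdW0 χ 𝔪 (cmFinLocalFamily L e dV hdV hdV0 dW hdW hdW0 χ hχ 𝔪))
        hW' hJW').omegaLoc v).IsL2Isometric (Measure.pi fun _ : Fin n => μ') :=
  isL2Isometric_omegaLoc_congrW L e dV hdV dW hdW v hT hJ _ hW' hJW' _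
    (isL2Isometric_omegaLoc_undoubledSplittings_cmFinLocalFamily L e dV hdV hdV0 dW hdW hdW0 χ hχ 𝔪 v hχu μ')

end Literature.NumberTheory.GelbartRogawski1991.GRConstruction

end
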